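import Summits.BirchSwinnertonDyer.Rank1Residual.X2.RankOneNonsplitCertificate
import Summits.BirchSwinnertonDyer.Rank1Residual.X1.RankOneParitySqueeze
import Literature.NumberTheory.EllipticCurves.KellerYin2024.MultiplicativeReduction
import Literature.NumberTheory.EllipticCurves.KatoRankBoundSelmerProofs
import Literature.NumberTheory.EllipticCurves.KatoRankBoundProofs
import Literature.NumberTheory.EllipticCurves.BSDSelmerParityDokchitserTwistFormProofs
import Literature.NumberTheory.EllipticCurves.LeadingTermProofs
import Literature.NumberTheory.EllipticCurves.AnalyticRankModularityProofs
import Literature.NumberTheory.EllipticCurves.PAdicLFunctionNonsplitMultiplicativeExistenceProofs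
import Literature.NumberTheory.EllipticCurves.Wuthrich2014.ReducibleMultiplicativeDivisibility
import HarnessLib

/-!
# Crux 3 `MazurMCOnCellB` (stmt-BirchSwinnertonDyer-19033), line `twistback` v4 — road (d′):
# the partner's ANALYTIC RANK as an OUTPUT of the two-engine certificate `(μ_an, λ_an) = (0, 1)`
# (λ-bound on the Selmer corank + p-parity + the multiplicative Eisenstein `p`-converse)

Width seat bsd-line-x2-p1-w5 (g0), 2026-08-28. HONEST FRAMING (cell `bsd-eis`, run/shared/lean/pub/bsd-eis/):
conditional theorems only. Named facts taken as hypotheses BY NAME: Wuthrich 2014 Thm. 16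
(`thm16_charIdeal_dvd_multiplicative_of_reducible`), the parametrisation supply (`nonempty_modularParametrizationData`)
and modularity (`exists_isNewformOf`) — conjuncts of the route's `PublishedInputs` (stmt-…-19037) —, Dokchitser–Dokchitser
2010 Thm. 1.4 in the analytic form `selmerCorank_mod_two_eq` (PUB), and the `p`-converse at a MULTIPLICATIVE
Eisenstein prime `KellerYin2024.thmE_pConverse_semistable_OPEN` (Keller–Yin arXiv:2402.12781v2 Thm. E = Cor. 5.2.2,
an UNREFEREED PREPRINT, itself resting on Castella arXiv:2409.01360 — every theorem below that carries `hKY` is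
conditional on that OPEN claim; the line already carries Keller–Yin Thm. D, PRE, as stub 3a). No `def`, no `sorry`;
no main conjecture / BSD is proved for any curve unconditionally; 0 cells / labels / stubs / tiers move.

WHY (this seat's audit `Cruxes/MazurMCOnCellB/Lines/twistback-krizli-supply-audit-w5.md`, evidence on -19033
2026-08-28T16:36Z): LEAD g10's road (d) (`…TwistbackKLFlatPartner` §3 `upperPartner_at_of_klFlat_partner`) asks per
pair for ONE admissible `K` with (i) `ord_{s=1} L(E^{(d_K)}, s) = 1`, (ii) a KL-flat carrier, (iii) local balance
`c(E) = 1`, and hoped to get (i) class-wide from Kriz–Li 2019 Thm. 1.20 / Thm. 9.4. That hope is void: Kriz–Li's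
hypotheses ((2) no split multiplicative prime, (3) the additive conditions) say exactly that NO Euler factor of
their congruence (29) vanishes mod `3`, i.e. `c(E) = 0`, while `c(E) ≥ 1` on every non-split X2b pair (44/44 census
cells; structurally by the sign `w(E^K) = −1`). This file removes input (i) altogether: at the carrier `V′` the
certificate `(μ_an, λ_an) = (0, 1)` (produced from character data by `…LambdaFromCharacters`) gives
`corank_{ℤ_p} Sel_{p^∞}(V′/ℚ) ≤ 1` WITHOUT any rank input (§1), `p`-parity and the odd analytic rank of a Heegner
twist of a rank-zero curve make it `= 1` (§2), and the multiplicative Eisenstein `p`-converse turns that into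
`ord_{s=1} L(V′, s) = 1` (§3); the sequel file is road (d)'s door with its hypothesis `hr1` DISCHARGED.

* §1 `selmerCorank_le_one_of_analyticLambdaEq_one` — `W` globally minimal, `p ≠ 2` NON-split multiplicative,
  `E[p]` reducible, `AnalyticMuLE W p 0 ∧ AnalyticLambdaEq W p 1` ⟹ `corank Sel_{p^∞}(E/ℚ) ≤ 1`. Proof: Wuthrich
  Thm. 16 at the tree's cyclotomic datum (`g ∈ char_Λ X`, `ι g = ϖ·L`), `λ(g) = 1`, and the tree theorems
  `selmerCorank_le_coinvariantsRank` (Greenberg LNM 1716 Lemma 3.1), `coinvariantsRank_le_order_of_mem_charIdeal`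
  (structure theorem), `order_le_lam`. PUB inputs only.
* §2 `selmerCorank_eq_one_of_analyticLambdaEq_one_of_odd` (+ Dokchitser: `corank ≡ r_an (mod 2)`, `r_an` odd) and
  `odd_analyticRank_quadraticTwist_of_analyticRank_eq_zero` (`r_an(E) = 0`, `K` Heegner ⟹ `r_an(E^{(d_K)})` odd;
  modularity only: `odd_analyticRankEK_of_satisfiesHeegnerHypothesis_of_exists_isNewformOf` + `analyticRankEK_eq_add`).
* §3 `analyticRank_eq_one_of_analyticLambdaEq_one_of_odd` (+ Keller–Yin Thm. E, mult half): `r_an(W) = 1`.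
* (sequel file `…TwistbackLamOnePartner`, proposed once p645525's olean is on the farm)
  `upperPartner_at_of_klFlat_partner_of_thmE` — VERBATIM the conclusion of stub 6 at `(W, p)` from the hypotheses of
  p645525 §3 MINUS `hr1 : (W.quadraticTwist d_K).analyticRank = 1`, plus `hDD` and `hKY`.

References: [Wuthrich2014] Thm. 16 (p. 397); [GreenbergLNM1716] §1 p. 65, §3 Lemma 3.1; [Washington1997] §7.1,
Thm. 13.12; [DokchitserDokchitserAnnals2010] Thm. 1.4; [Darmon2004] §3.6 Thm. 3.15/3.17; [KellerYin2024] Thm. E =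
Thm. 4.1.1 + Cor. 5.2.2 (arXiv:2402.12781v2, PRE); [GreenbergVatsal2000] §3 Thm. (3.11); [Disegni2020] Thm. 4.
-/

set_option autoImplicit false
-- `Summit.BirchSwinnertonDyer.BirchSwinnertonDyer.…`: the summit and its single sub-problem share a name.
set_option linter.dupNamespace false

noncomputable section

open scoped Classical MatrixGroups ModularForm

open CongruenceSubgroup WeierstrassCurve NumberField IsDedekindDomain Field PowerSeries
  Literature.NumberTheory.EllipticCurves
  Literature.NumberTheory.GaloisRepresentations
  Literature.NumberTheory.EllipticCurves.ModularForms
  Literature.NumberTheory.EllipticCurves.Rank1Residual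
  Literature.NumberTheory.EllipticCurves.Rank1Residual.Typed
  Literature.NumberTheory.EllipticCurves.Wuthrich2014
  Literature.NumberTheory.EllipticCurves.KellerYin2024
  Literature.NumberTheory.EllipticCurves.IwasawaAlgebra
  Summit.BirchSwinnertonDyer.Rank1Residual
  Summit.BirchSwinnertonDyer.Rank1Residual.X2
  Summit.BirchSwinnertonDyer.Rank1Residual.X1.MuLambda
  Summit.BirchSwinnertonDyer.Rank1Residual.X1.RankOneParitySqueeze

namespace Summit.BirchSwinnertonDyer.BirchSwinnertonDyer.Theorems.EisensteinPrimesMazurMCOnCellBTwistbackLamOneRankOne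

/-! ## §1. `(μ_an, λ_an) = (0, 1)` at a non-split multiplicative Eisenstein prime bounds the Selmer corank by `1` -/

/-- **`λ_an = 1 ⟹ corank_{ℤ_p} Sel_{p^∞}(E/ℚ) ≤ 1`, no rank input.** Data: `W/ℚ` globally minimal, `p ≠ 2` of
NON-split multiplicative reduction, `E[p]` reducible; the two finite certificates `X2.AnalyticMuLE W p 0` (some
coefficient of `ϖ·L` is a unit — used only for `ϖ·L ≠ 0`) and `X2.AnalyticLambdaEq W p 1` on THE non-split
Mazur–Tate–Teitelbaum function. Published inputs BY NAME: Wuthrich 2014 Thm. 16 (`hWu`: at the tree's cyclotomic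
datum `(κ, γ)` and Selmer dual `D`, some `g ∈ char_Λ X(E/ℚ_∞)` has `ι g = ϖ·L`) and the parametrisation supply
(`hpar`, for a newform `f` and a `ϖ ∈ ℚ` with `ϖ·Ω_E = Ω⁺_f`). Then `λ(g) = 1`, so `ord_{T=0} g ≤ 1`
(`order_le_lam`), so `rank_{ℤ_p} X/TX ≤ 1` (structure theorem, `coinvariantsRank_le_order_of_mem_charIdeal`), so
`corank Sel_{p^∞}(E/ℚ) ≤ 1` (Greenberg's Lemma 3.1, `selmerCorank_le_coinvariantsRank`).
[cite: Wuthrich2014, Thm. 16 (p. 397)] [cite: GreenbergLNM1716, §1 p. 65 and §3 Lemma 3.1] [cite: Washington1997, §7.1 and Thm. 13.12] -/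
theorem selmerCorank_le_one_of_analyticLambdaEq_one (hWu : thm16_charIdeal_dvd_multiplicative_of_reducible)
    (hpar : nonempty_modularParametrizationData)
    (W : WeierstrassCurve ℚ) [W.IsElliptic] [W.IsGloballyMinimal] (p : ℕ) [Fact p.Prime]
    (hp2 : p ≠ 2) (hmult : W.HasMultiplicativeReductionAtPrime p)
    (hns : ¬ W.HasSplitMultiplicativeReductionAtPrime p) (hred : ¬ W.HasIrreducibleModPGaloisRep p)
    (hμ0 : AnalyticMuLE W p 0) (hlam : AnalyticLambdaEq W p 1) :
    W.selmerCorank p ≤ 1 := by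
  -- the cyclotomic datum, the Selmer dual, a newform with its `ϖ`, THE non-split `p`-adic `L`-function
  obtain ⟨κ, hκ, γ, hγ, hγ'⟩ := exists_isCyclotomic_isTopGenerator_isCyclotomicVariable_holds p
  obtain ⟨D⟩ := W.nonempty_selmerDualData_holds κ γ hγ
  haveI : NeZero (W.conductorNorm ℤ) := ⟨(W.conductorNorm_pos_holds).ne'⟩
  obtain ⟨Dm⟩ := hpar W
  obtain ⟨ϖ, -, hϖ, -⟩ := Dm.exists_rat_mul_realPeriodRat_eq_plusPeriod
  obtain ⟨L, hL⟩ := exists_isMultPAdicLFunctionOf_neg_one_of_nonsplit Dm.isNewformOf hmult hns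
  haveI : Module.Finite (IwasawaAlgebra p) D.X := D.module_finite_holds hγ
  -- Wuthrich Thm. 16: `X` torsion and `g ∈ char X` with `ι g = ϖ·L`
  obtain ⟨hX, hKns, -⟩ := hWu W p hp2 hmult hred hκ hγ hγ' Dm.isNewformOf D ϖ hϖ
  obtain ⟨g, hg, hιg⟩ := hKns hns L hL
  -- `λ(g) = 1` and `g ≠ 0`
  have hlamg : lam g = 1 :=
    hlam Dm.f Dm.isNewformOf ϖ hϖ L (fun hs ↦ absurd hs hns) (fun _ ↦ hL) g hιg
  obtain ⟨k, hk⟩ := hμ0 Dm.f Dm.isNewformOf ϖ hϖ L (fun hs ↦ absurd hs hns) (fun _ ↦ hL)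
  have hL0 : PowerSeries.C ((ϖ : ℚ) : ℚ_[p]) * L ≠ 0 := ne_zero_of_lt_norm_coeff hk
  have hg0 : g ≠ 0 := by
    rintro rfl
    exact hL0 (by rw [← hιg, map_zero])
  -- the squeeze `corank Sel ≤ rank X/TX ≤ ord_T g ≤ λ(g) = 1`
  have h1 : W.selmerCorank p ≤ coinvariantsRank p D.X := W.selmerCorank_le_coinvariantsRank hγ D
  have h2 : (coinvariantsRank p D.X : ℕ∞) ≤ g.order :=
    coinvariantsRank_le_order_of_mem_charIdeal D.X hX g hg
  have h3 : g.order ≤ ((lam g : ℕ) : ℕ∞) := order_le_lam hg0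
  have h4 : (coinvariantsRank p D.X : ℕ∞) ≤ ((1 : ℕ) : ℕ∞) := by
    rw [← hlamg]; exact h2.trans h3
  have h5 : coinvariantsRank p D.X ≤ 1 := by exact_mod_cast h4
  exact h1.trans h5

/-! ## §2. Parity: the corank is exactly `1` when the analytic rank is odd; the twist's analytic rank IS odd -/

/-- **`(μ_an, λ_an) = (0, 1)` ∧ `ord_{s=1} L(E, s)` odd ⟹ `corank_{ℤ_p} Sel_{p^∞}(E/ℚ) = 1`** — §1 plus the
`p`-parity theorem in analytic form (`hDD : selmerCorank_mod_two_eq W p`, Dokchitser–Dokchitser 2010 Thm. 1.4 with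
the functional equation; PUB named fact). [cite: DokchitserDokchitserAnnals2010, Thm. 1.4]
[cite: Wuthrich2014, Thm. 16 (p. 397)] [cite: GreenbergLNM1716, §3 Lemma 3.1] -/
theorem selmerCorank_eq_one_of_analyticLambdaEq_one_of_odd
    (hWu : thm16_charIdeal_dvd_multiplicative_of_reducible) (hpar : nonempty_modularParametrizationData)
    (W : WeierstrassCurve ℚ) [W.IsElliptic] [W.IsGloballyMinimal] (p : ℕ) [Fact p.Prime]
    (hDD : selmerCorank_mod_two_eq W p)
    (hp2 : p ≠ 2) (hmult : W.HasMultiplicativeReductionAtPrime p)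
    (hns : ¬ W.HasSplitMultiplicativeReductionAtPrime p) (hred : ¬ W.HasIrreducibleModPGaloisRep p)
    (hodd : Odd W.analyticRank) (hμ0 : AnalyticMuLE W p 0) (hlam : AnalyticLambdaEq W p 1) :
    W.selmerCorank p = 1 := by
  have hle := selmerCorank_le_one_of_analyticLambdaEq_one hWu hpar W p hp2 hmult hns hred hμ0 hlam
  have hmod : W.selmerCorank p % 2 = W.analyticRank % 2 := hDD
  rcases hodd with ⟨k, hk⟩
  omega

/-- **The Heegner twist of an analytic-rank-zero curve has ODD analytic rank** (modularity only): for `W/ℚ`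
elliptic with `ord_{s=1} L(E, s) = 0` and `K` imaginary quadratic in which every prime dividing `N_E` splits,
`ord_{s=1} L(E^{(d_K)}, s)` is odd — since `ord_{s=1} L(E/K, s) = ord L(E, s) + ord L(E^{(d_K)}, s)` is odd
(Darmon 2004, §3.6: `sign(E, K) = −1`; tree theorems
`odd_analyticRankEK_of_satisfiesHeegnerHypothesis_of_exists_isNewformOf`, `analyticRankEK_eq_add_holds_of`, both from
`exists_isNewformOf` = BCDT 2001 Thm. A). [cite: Darmon2004, §3.6 Thm. 3.15 and Thm. 3.17] [cite: BCDTJAMS2001, Thm. A] -/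
theorem odd_analyticRank_quadraticTwist_of_analyticRank_eq_zero (hnf : exists_isNewformOf)
    (W : WeierstrassCurve ℚ) [W.IsElliptic] (hr : W.analyticRank = 0)
    (K : Type) [Field K] [NumberField K] (hK : IsImaginaryQuadratic K)
    (hH : SatisfiesHeegnerHypothesis (W.conductorNorm ℤ) K) :
    Odd (W.quadraticTwist (NumberField.discr K : ℚ)).analyticRank := by
  have hE : WeierstrassCurve.hasEntireLFunction_rat :=
    WeierstrassCurve.hasEntireLFunction_rat_of_exists_isNewformOf hnf
  have hodd : Odd (analyticRankEK W K) :=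
    odd_analyticRankEK_of_satisfiesHeegnerHypothesis_of_exists_isNewformOf hnf W K hK hH
  have hadd : analyticRankEK W K =
      W.analyticRank + (W.quadraticTwist (NumberField.discr K : ℚ)).analyticRank :=
    analyticRankEK_eq_add_holds_of hE W K
  rwa [hadd, hr, zero_add] at hodd

/-! ## §3. The multiplicative Eisenstein `p`-converse turns `corank = 1` into `ord_{s=1} L(E, s) = 1` -/

/-- **Road (d′), core: `(μ_an, λ_an) = (0, 1)` ∧ `r_an` odd ⟹ `ord_{s=1} L(E, s) = 1` at a non-split multiplicative
Eisenstein prime `p ≠ 2`**, from §2 and Keller–Yin's `p`-converse at a MULTIPLICATIVE Eisenstein prime (`hKY` =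
`KellerYin2024.thmE_pConverse_semistable_OPEN`, Thm. E / Cor. 5.2.2 of arXiv:2402.12781v2 — an UNREFEREED claim;
this theorem is conditional on it). NO Heegner point, NO `p`-adic height, NO complex or `p`-adic Gross–Zagier
formula at the curve enters. [claim: KellerYin2024, status: under-review]
[cite: DokchitserDokchitserAnnals2010, Thm. 1.4] [cite: Wuthrich2014, Thm. 16 (p. 397)] -/
theorem analyticRank_eq_one_of_analyticLambdaEq_one_of_odd
    (hWu : thm16_charIdeal_dvd_multiplicative_of_reducible) (hpar : nonempty_modularParametrizationData)
    (hKY : thmE_pConverse_semistable_OPEN)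
    (W : WeierstrassCurve ℚ) [W.IsElliptic] [W.IsGloballyMinimal] (p : ℕ) [Fact p.Prime]
    (hDD : selmerCorank_mod_two_eq W p)
    (hp2 : p ≠ 2) (hmult : W.HasMultiplicativeReductionAtPrime p)
    (hns : ¬ W.HasSplitMultiplicativeReductionAtPrime p) (hred : ¬ W.HasIrreducibleModPGaloisRep p)
    (hodd : Odd W.analyticRank) (hμ0 : AnalyticMuLE W p 0) (hlam : AnalyticLambdaEq W p 1) :
    W.analyticRank = 1 := by
  have hpP : p.Prime := Fact.out
  have hp : 2 < p := lt_of_le_of_ne hpP.two_le (Ne.symm hp2)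
  have hcork := selmerCorank_eq_one_of_analyticLambdaEq_one_of_odd hWu hpar W p hDD hp2 hmult hns hred hodd
    hμ0 hlam
  exact hKY W p hp (Or.inr hmult) hred 1 (Or.inr rfl) hcork


end Summit.BirchSwinnertonDyer.BirchSwinnertonDyer.Theorems.EisensteinPrimesMazurMCOnCellBTwistbackLamOneRankOne

end
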